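import Summits.ValiantsHypothesis.ValiantsHypothesis.Theses.TwistedDetRank

/-!
# ValiantsHypothesis / TwistedDetRank — item `FermionicNormalFormOfSlices` (stmt-ValiantsHypothesis-17993), closed

Glue of the BC2 redirect of the deciding crux of route `TwistedDetRank`:
`SliceVPInVBP → SliceVBPFermionic → FermionicNormalForm` — a p-computable class-function slice family
has polynomial determinantal complexity (`SliceVPInVBP`), and such families admit the fermionic
normal form (`SliceVBPFermionic`); composing gives `FermionicNormalForm`. Pure logic (the proof term
recorded on the item by the planner). HONEST FRAMING: bookkeeping; both hypotheses are OPEN cruxes;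
nothing here is progress on `VP ≠ VNP`.
-/

-- layout Summits/ValiantsHypothesis/ValiantsHypothesis forces the duplicated namespace component
set_option linter.dupNamespace false

namespace Summit.ValiantsHypothesis.ValiantsHypothesis.Theorems.TwistedDetRank

/-- **Item `FermionicNormalFormOfSlices` (stmt-ValiantsHypothesis-17993):**
`SliceVPInVBP → SliceVBPFermionic → FermionicNormalForm`, by composition. [folklore] -/
theorem fermionicNormalFormOfSlices_proof : Theses.TwistedDetRank.FermionicNormalFormOfSlices := by
  unfold Theses.TwistedDetRank.FermionicNormalFormOfSlices
  intro h1 h2 χ hχ hc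
  exact h2 χ hχ (h1 χ hχ hc)

end Summit.ValiantsHypothesis.ValiantsHypothesis.Theorems.TwistedDetRank
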